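import Literature.Computability.QuantumComplexity.PauliPathOrthogonality
import HarnessLib

/-!
# The noisy linear XEB is the damped Fourier-weight polynomial (Aharonov–Gao–Landau–Liu–Vazirani 2023, §5)

Topic `Literature/Computability/QuantumComplexity`, sub-namespace `PauliPath`; sequel of
`PauliPathOrthogonality.lean` (cell `qa-dq`: census rows DQ-N1 / DQ-B8; the identity is the first
lemma of the lines `xeb-pauli-path-dichotomy` and `truncation-class-xeb-ceiling`, where it was stated
over the tree's declarations as `sum_frame_sum_noisyValue_zero_mul_noisyValue`).

HONEST FRAMING: nothing here proves or refutes quantum advantage; an exact finite identity for a FIXED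
layer sequence averaged over the uniformly random Pauli FRAMES of `PauliPathOrthogonality.lean`
(Definition 3's example ensemble), any input `ρ`, any noise rate; no sampler or spoofer is involved.

## Source (read on the page: `lit read arxiv:2211.03999`, tex chunk p0016 L57–66)

D. Aharonov, X. Gao, Z. Landau, Y. Liu, U. Vazirani, *A polynomial-time classical algorithm for noisy
random circuit sampling*, STOC 2023 = arXiv:2211.03999 [AharonovEtAl2023], §5 (before Theorem 4):
"A useful property is that the XEB of noisy random circuits can be viewed as the Fourier weight
polynomial. `XEB = 2ⁿ E_C Σ_x p(C,x) q(C,x) − 1 = 2ⁿ E_C Σ_x Σ_s (1−γ)^{|s|} f(C,s,x)² − 1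
= 2^{2n} E_C Σ_s (1−γ)^{|s|} f(C,s,0ⁿ)² − 1 = Σ_{k>0} (1−γ)^k W_k.` Here, the second line follows
from the Pauli path integral and orthogonality (Lemma 3); the third line is by Eq. (eq:boundarysign);
the fourth line is by definition of Fourier weight and the fact that `W_0 = 1`" (with `q = p̃` the
noisy and `p` the ideal output distribution).

## What is proved (0 named facts)

For the Pauli-frame ensemble of a fixed layer sequence (`frameLayers U W`, `frameObs (proj x) W`,
frames `W : Fin (d+1) → ι → Pauli`, frame count `(4^{|ι|})^{d+1}`):

* `sum_frame_pathCoeff_mul_pathCoeff₂`, `sum_frame_pathCoeff_mul_pathCoeff_self₂`,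
  `sum_frame_sum_mul_sum_pathCoeff` — Lemma 3's orthogonality with TWO noise rates (the frames act on
  `f̃(·;γ)` by the same signs at every rate, `pathCoeff_frame`), i.e. the "second line" above;
* **`sum_frame_sum_noisyValue_zero_mul_noisyValue`** — the displayed chain in frame-summed form:
  `2ⁿ Σ_W Σ_x p_W(x) p̃_W(x) = (4ⁿ)^{d+1} Σ_{k=0}^{n(d+1)} (1−γ)^k W_k` (`W_k = fourierWeight 0`), for
  every input `ρ`, every reference output `x₀` and every `γ : ℂ` (the printed line subtracts
  `W_0 = 1` to get `XEB = Σ_{k>0}(1−γ)^k W_k`; `W_0 = 1` for unitary layers and basis input is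
  `fourierWeight_zero` of `PauliPathLegal.lean`, not re-derived here);
* `sum_frame_sum_noisyValue_mul_noisyValue` — the same with two arbitrary rates `γ₁, γ₂`
  (`Σ_k (1−γ₁)^k (1−γ₂)^k W_k`), of which the display is the case `γ₁ = 0`.

Tree lemmas used: `noisyValue_eq_sum_pathCoeff`, `pathCoeff_frame`, `sum_strSign_mul_strSign`,
`pathCoeff_eq_pow_mul_pathCoeff_zero`, `pathCoeff_zero_proj_sq`, `pathWeight_le`, `fourierWeight`.
-/

noncomputable section

open Matrix Finset

namespace Literature.Computability.QuantumComplexity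

namespace PauliPath

variable {ι : Type*} [Fintype ι] [DecidableEq ι]

/-! ### Lemma 3 with two noise rates -/

/-- **Lemma 3 (orthogonality over the frames), two-rate form**: for Pauli paths `s ≠ s'` and any two
noise rates, `Σ_W f̃(C_W,s;γ₁) f̃(C_W,s';γ₂) = 0` — the frames act by the same signs at every rate.
[cite: AharonovEtAl2023, Lemma 3 (and §5, "the second line follows from … orthogonality")] -/
theorem sum_frame_pathCoeff_mul_pathCoeff₂ (γ₁ γ₂ : ℂ) {d : ℕ}
    (U : Fin d → Matrix (ι → Bool) (ι → Bool) ℂ) (ρ O₁ O₂ : Matrix (ι → Bool) (ι → Bool) ℂ)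
    {s s' : Fin (d + 1) → ι → Pauli} (h : s ≠ s') :
    ∑ W : Fin (d + 1) → ι → Pauli,
      pathCoeff γ₁ (frameLayers U W) ρ (frameObs O₁ W) s *
        pathCoeff γ₂ (frameLayers U W) ρ (frameObs O₂ W) s' = 0 := by
  have hre : ∀ W : Fin (d + 1) → ι → Pauli,
      (∏ t, strSign (W t) (s t)) * pathCoeff γ₁ U ρ O₁ s *
        ((∏ t, strSign (W t) (s' t)) * pathCoeff γ₂ U ρ O₂ s') =
      (∏ t, strSign (W t) (s t) * strSign (W t) (s' t)) *
        (pathCoeff γ₁ U ρ O₁ s * pathCoeff γ₂ U ρ O₂ s') := by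
    intro W; rw [Finset.prod_mul_distrib]; ring
  simp only [pathCoeff_frame, hre, ← Finset.sum_mul]
  rw [← Fintype.prod_sum (fun t V => strSign V (s t) * strSign V (s' t))]
  simp only [sum_strSign_mul_strSign]
  obtain ⟨t, ht⟩ : ∃ t, s t ≠ s' t := by
    by_contra hc
    push Not at hc
    exact h (funext hc)
  rw [Finset.prod_eq_zero (Finset.mem_univ t) (if_neg ht), zero_mul]

/-- The matched case with two rates: `Σ_W f̃(C_W,s;γ₁) f̃(C_W,s;γ₂) = (4^{|ι|})^{d+1} f̃(C,s;γ₁) f̃(C,s;γ₂)`.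
[cite: AharonovEtAl2023, Lemma 3 (proof) and Definition 5] -/
theorem sum_frame_pathCoeff_mul_pathCoeff_self₂ (γ₁ γ₂ : ℂ) {d : ℕ}
    (U : Fin d → Matrix (ι → Bool) (ι → Bool) ℂ) (ρ O₁ O₂ : Matrix (ι → Bool) (ι → Bool) ℂ)
    (s : Fin (d + 1) → ι → Pauli) :
    ∑ W : Fin (d + 1) → ι → Pauli,
      pathCoeff γ₁ (frameLayers U W) ρ (frameObs O₁ W) s *
        pathCoeff γ₂ (frameLayers U W) ρ (frameObs O₂ W) s =
      ((4 : ℂ) ^ Fintype.card ι) ^ (d + 1) * (pathCoeff γ₁ U ρ O₁ s * pathCoeff γ₂ U ρ O₂ s) := by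
  have hre : ∀ W : Fin (d + 1) → ι → Pauli,
      (∏ t, strSign (W t) (s t)) * pathCoeff γ₁ U ρ O₁ s *
        ((∏ t, strSign (W t) (s t)) * pathCoeff γ₂ U ρ O₂ s) =
      (∏ t, strSign (W t) (s t) * strSign (W t) (s t)) *
        (pathCoeff γ₁ U ρ O₁ s * pathCoeff γ₂ U ρ O₂ s) := by
    intro W; rw [Finset.prod_mul_distrib]; ring
  simp only [pathCoeff_frame, hre, ← Finset.sum_mul]
  rw [← Fintype.prod_sum (fun t V => strSign V (s t) * strSign V (s t))]
  simp only [sum_strSign_mul_strSign, if_true, Finset.prod_const, Finset.card_univ, Fintype.card_fin]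

/-- **The "second line" of the §5 display**: the frame sum of a product of two path sums (two rates,
two read-outs) keeps only the diagonal `s = s'`:
`Σ_W (Σ_{s∈T} f̃(C_W,s;γ₁)) (Σ_{s∈T} f̃(C_W,s;γ₂)) = (4^{|ι|})^{d+1} Σ_{s∈T} f̃(C,s;γ₁) f̃(C,s;γ₂)`.
[cite: AharonovEtAl2023, §5 (display before Theorem 4, second line) and Lemma 3] -/
theorem sum_frame_sum_mul_sum_pathCoeff (γ₁ γ₂ : ℂ) {d : ℕ}
    (U : Fin d → Matrix (ι → Bool) (ι → Bool) ℂ) (ρ O₁ O₂ : Matrix (ι → Bool) (ι → Bool) ℂ)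
    (T : Finset (Fin (d + 1) → ι → Pauli)) :
    ∑ W : Fin (d + 1) → ι → Pauli,
      (∑ s ∈ T, pathCoeff γ₁ (frameLayers U W) ρ (frameObs O₁ W) s) *
        (∑ s ∈ T, pathCoeff γ₂ (frameLayers U W) ρ (frameObs O₂ W) s) =
      ((4 : ℂ) ^ Fintype.card ι) ^ (d + 1) *
        ∑ s ∈ T, pathCoeff γ₁ U ρ O₁ s * pathCoeff γ₂ U ρ O₂ s := by
  set c : ℂ := ((4 : ℂ) ^ Fintype.card ι) ^ (d + 1) with hc
  calc ∑ W : Fin (d + 1) → ι → Pauli,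
        (∑ s ∈ T, pathCoeff γ₁ (frameLayers U W) ρ (frameObs O₁ W) s) *
          (∑ s ∈ T, pathCoeff γ₂ (frameLayers U W) ρ (frameObs O₂ W) s)
      = ∑ W : Fin (d + 1) → ι → Pauli, ∑ s ∈ T, ∑ s' ∈ T,
          pathCoeff γ₁ (frameLayers U W) ρ (frameObs O₁ W) s *
            pathCoeff γ₂ (frameLayers U W) ρ (frameObs O₂ W) s' := by
        simp only [Finset.sum_mul_sum]
    _ = ∑ s ∈ T, ∑ s' ∈ T, ∑ W : Fin (d + 1) → ι → Pauli,
          pathCoeff γ₁ (frameLayers U W) ρ (frameObs O₁ W) s *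
            pathCoeff γ₂ (frameLayers U W) ρ (frameObs O₂ W) s' := by
        rw [Finset.sum_comm]
        exact Finset.sum_congr rfl fun s _ => Finset.sum_comm
    _ = ∑ s ∈ T, ∑ s' ∈ T,
          (if s = s' then c * (pathCoeff γ₁ U ρ O₁ s * pathCoeff γ₂ U ρ O₂ s) else 0) := by
        refine Finset.sum_congr rfl fun s _ => Finset.sum_congr rfl fun s' _ => ?_
        split_ifs with h
        · subst h
          exact sum_frame_pathCoeff_mul_pathCoeff_self₂ γ₁ γ₂ U ρ O₁ O₂ s
        · exact sum_frame_pathCoeff_mul_pathCoeff₂ γ₁ γ₂ U ρ O₁ O₂ h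
    _ = c * ∑ s ∈ T, pathCoeff γ₁ U ρ O₁ s * pathCoeff γ₂ U ρ O₂ s := by
        rw [Finset.mul_sum]
        refine Finset.sum_congr rfl fun s hs => ?_
        rw [Finset.sum_ite_eq, if_pos hs]

/-! ### The XEB display: frame-summed overlap of two noisy output vectors = damped Fourier weights -/

/-- **Two-rate overlap**: `2ⁿ Σ_W Σ_x p̃_W(x;γ₁) p̃_W(x;γ₂) = (4ⁿ)^{d+1} Σ_{k=0}^{n(d+1)} ((1−γ₁)(1−γ₂))^k W_k`
with `W_k = fourierWeight 0 U ρ x₀ k` (any input `ρ`, any reference output `x₀`): path integral for both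
factors, orthogonality over the frames, `f̃(s;γ) = (1−γ)^{|s|} f(s)`, `f(C,s,x)² = f(C,s,x₀)²`, and
regrouping by degree. [cite: AharonovEtAl2023, §5 (display before Theorem 4: the four-line chain)] -/
theorem sum_frame_sum_noisyValue_mul_noisyValue (γ₁ γ₂ : ℂ) {d : ℕ}
    (U : Fin d → Matrix (ι → Bool) (ι → Bool) ℂ) (ρ : Matrix (ι → Bool) (ι → Bool) ℂ) (x₀ : ι → Bool) :
    (2 : ℂ) ^ Fintype.card ι * ∑ W : Fin (d + 1) → ι → Pauli, ∑ x : ι → Bool,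
        noisyValue γ₁ (frameLayers U W) ρ (frameObs (proj x) W) *
          noisyValue γ₂ (frameLayers U W) ρ (frameObs (proj x) W) =
      ((4 : ℂ) ^ Fintype.card ι) ^ (d + 1) *
        ∑ k ∈ Finset.range (Fintype.card ι * (d + 1) + 1),
          ((1 - γ₁) * (1 - γ₂)) ^ k * fourierWeight 0 U ρ x₀ k := by
  classical
  set c : ℂ := ((4 : ℂ) ^ Fintype.card ι) ^ (d + 1) with hc
  -- each `x`: path integral twice, orthogonality, damping, and independence of `x`
  have hx : ∀ x : ι → Bool, ∑ W : Fin (d + 1) → ι → Pauli,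
      noisyValue γ₁ (frameLayers U W) ρ (frameObs (proj x) W) *
        noisyValue γ₂ (frameLayers U W) ρ (frameObs (proj x) W) =
      c * ∑ s : Fin (d + 1) → ι → Pauli,
        ((1 - γ₁) * (1 - γ₂)) ^ pathWeight s * pathCoeff 0 U ρ (proj x₀) s ^ 2 := by
    intro x
    have h := sum_frame_sum_mul_sum_pathCoeff γ₁ γ₂ U ρ (proj x) (proj x) Finset.univ
    simp only [← noisyValue_eq_sum_pathCoeff] at h
    rw [h]
    congr 1
    refine Finset.sum_congr rfl fun s _ => ?_
    rw [pathCoeff_eq_pow_mul_pathCoeff_zero γ₁, pathCoeff_eq_pow_mul_pathCoeff_zero γ₂,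
      mul_mul_mul_comm, ← mul_pow, ← sq, pathCoeff_zero_proj_sq U ρ x x₀ s]
  -- regrouping by degree: `Σ_s t^{|s|} f(s)² = (2ⁿ)^{-2} Σ_k t^k W_k`
  have hgroup : ∑ k ∈ Finset.range (Fintype.card ι * (d + 1) + 1),
      ((1 - γ₁) * (1 - γ₂)) ^ k * fourierWeight 0 U ρ x₀ k =
      ((2 : ℂ) ^ Fintype.card ι) ^ 2 * ∑ s : Fin (d + 1) → ι → Pauli,
        ((1 - γ₁) * (1 - γ₂)) ^ pathWeight s * pathCoeff 0 U ρ (proj x₀) s ^ 2 := by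
    simp only [fourierWeight, Finset.mul_sum]
    rw [← Finset.sum_fiberwise_of_maps_to (s := Finset.univ)
      (t := Finset.range (Fintype.card ι * (d + 1) + 1)) (g := fun s => pathWeight s)
      (fun s _ => Finset.mem_range.2 (Nat.lt_succ_of_le (pathWeight_le s)))]
    refine Finset.sum_congr rfl fun k _ => Finset.sum_congr rfl fun s hs => ?_
    rw [(Finset.mem_filter.1 hs).2]
    ring
  rw [Finset.sum_comm, Finset.sum_congr rfl fun x _ => hx x, Finset.sum_const, Finset.card_univ,
    nsmul_eq_mul, Fintype.card_fun, Fintype.card_bool, hgroup]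
  push_cast
  ring

/-- **"The XEB of noisy random circuits can be viewed as the Fourier weight polynomial"** (frame-summed
form of the printed display, whose left side is `XEB + 1 = 2ⁿ E_C Σ_x p(C,x) q(C,x)` with `p` ideal and
`q = p̃` noisy): `2ⁿ Σ_W Σ_x p_W(x) p̃_W(x) = (4ⁿ)^{d+1} Σ_{k=0}^{n(d+1)} (1−γ)^k W_k`, any input `ρ`,
any `x₀`, any `γ`. Dividing by the frame count `(4ⁿ)^{d+1}` and subtracting `W_0` (`= 1` for unitary
layers and basis input, `fourierWeight_zero`) gives the printed `XEB = Σ_{k>0} (1−γ)^k W_k`.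
[cite: AharonovEtAl2023, §5 (display before Theorem 4)] -/
theorem sum_frame_sum_noisyValue_zero_mul_noisyValue (γ : ℂ) {d : ℕ}
    (U : Fin d → Matrix (ι → Bool) (ι → Bool) ℂ) (ρ : Matrix (ι → Bool) (ι → Bool) ℂ) (x₀ : ι → Bool) :
    (2 : ℂ) ^ Fintype.card ι * ∑ W : Fin (d + 1) → ι → Pauli, ∑ x : ι → Bool,
        noisyValue 0 (frameLayers U W) ρ (frameObs (proj x) W) *
          noisyValue γ (frameLayers U W) ρ (frameObs (proj x) W) =
      ((4 : ℂ) ^ Fintype.card ι) ^ (d + 1) *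
        ∑ k ∈ Finset.range (Fintype.card ι * (d + 1) + 1),
          (1 - γ) ^ k * fourierWeight 0 U ρ x₀ k := by
  rw [sum_frame_sum_noisyValue_mul_noisyValue 0 γ U ρ x₀]
  simp only [sub_zero, one_mul]

/-! ### Weighted (bilinear) form: arbitrary coefficient profiles on the paths

The same orthogonality for RE-WEIGHTED path sums `Σ_s a_s f̃(C_W,s)` — the shape in which the lines
`truncation-class-xeb-ceiling` / `xeb-pauli-path-dichotomy` of cell `qa-dq` state their first lemma
(profiles `a_s = (1−γ)^{|s|}` = the noisy device, `a_s = (1−γ′)^{|s|}·[|s| ≤ ℓ]` = the truncated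
estimator `truncValue`, `a_s = [s = s*]` = the single-path profile in the proof of Theorem 5 of the
source). -/

/-- **Bilinear frame orthogonality**: for arbitrary complex profiles `a, b` on the Pauli paths, two
noise rates and two read-outs,
`Σ_W (Σ_s a_s f̃(C_W,s;γ₁)) (Σ_s b_s f̃(C_W,s;γ₂)) = (4^{|ι|})^{d+1} Σ_s a_s b_s f̃(C,s;γ₁) f̃(C,s;γ₂)`.
[cite: AharonovEtAl2023, Lemma 3 (orthogonality) and §5 (its use for the noisy device and, in the proof of Theorem 5, for a single-path profile)] -/
theorem sum_frame_wsum_mul_wsum_pathCoeff (γ₁ γ₂ : ℂ) {d : ℕ}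
    (a b : (Fin (d + 1) → ι → Pauli) → ℂ)
    (U : Fin d → Matrix (ι → Bool) (ι → Bool) ℂ) (ρ O₁ O₂ : Matrix (ι → Bool) (ι → Bool) ℂ) :
    ∑ W : Fin (d + 1) → ι → Pauli,
      (∑ s, a s * pathCoeff γ₁ (frameLayers U W) ρ (frameObs O₁ W) s) *
        (∑ s, b s * pathCoeff γ₂ (frameLayers U W) ρ (frameObs O₂ W) s) =
      ((4 : ℂ) ^ Fintype.card ι) ^ (d + 1) *
        ∑ s, a s * b s * (pathCoeff γ₁ U ρ O₁ s * pathCoeff γ₂ U ρ O₂ s) := by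
  set c : ℂ := ((4 : ℂ) ^ Fintype.card ι) ^ (d + 1) with hc
  calc ∑ W : Fin (d + 1) → ι → Pauli,
        (∑ s, a s * pathCoeff γ₁ (frameLayers U W) ρ (frameObs O₁ W) s) *
          (∑ s, b s * pathCoeff γ₂ (frameLayers U W) ρ (frameObs O₂ W) s)
      = ∑ W : Fin (d + 1) → ι → Pauli, ∑ s, ∑ s',
          a s * b s' * (pathCoeff γ₁ (frameLayers U W) ρ (frameObs O₁ W) s *
            pathCoeff γ₂ (frameLayers U W) ρ (frameObs O₂ W) s') := by
        refine Finset.sum_congr rfl fun W _ => ?_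
        rw [Finset.sum_mul_sum]
        exact Finset.sum_congr rfl fun s _ => Finset.sum_congr rfl fun s' _ => by ring
    _ = ∑ s, ∑ s', a s * b s' * ∑ W : Fin (d + 1) → ι → Pauli,
          pathCoeff γ₁ (frameLayers U W) ρ (frameObs O₁ W) s *
            pathCoeff γ₂ (frameLayers U W) ρ (frameObs O₂ W) s' := by
        rw [Finset.sum_comm]
        refine Finset.sum_congr rfl fun s _ => ?_
        rw [Finset.sum_comm]
        exact Finset.sum_congr rfl fun s' _ => by rw [Finset.mul_sum]
    _ = ∑ s, ∑ s', (if s = s' then c * (a s * b s * (pathCoeff γ₁ U ρ O₁ s * pathCoeff γ₂ U ρ O₂ s))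
          else 0) := by
        refine Finset.sum_congr rfl fun s _ => Finset.sum_congr rfl fun s' _ => ?_
        split_ifs with h
        · subst h
          rw [sum_frame_pathCoeff_mul_pathCoeff_self₂ γ₁ γ₂ U ρ O₁ O₂ s]
          ring
        · rw [sum_frame_pathCoeff_mul_pathCoeff₂ γ₁ γ₂ U ρ O₁ O₂ h, mul_zero]
    _ = c * ∑ s, a s * b s * (pathCoeff γ₁ U ρ O₁ s * pathCoeff γ₂ U ρ O₂ s) := by
        rw [Finset.mul_sum]
        refine Finset.sum_congr rfl fun s _ => ?_
        rw [Finset.sum_ite_eq, if_pos (Finset.mem_univ s)]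

/-- **Bilinear frame orthogonality, read-out-summed form** (the first lemma of the `qa-dq` line
`truncation-class-xeb-ceiling`, verbatim): for arbitrary complex profiles `a, b`,
`2ⁿ Σ_W Σ_x (Σ_s a_s f(C_W,s,x)) (Σ_s b_s f(C_W,s,x)) = (4ⁿ)^{d+1} Σ_s a_s b_s · (2ⁿ)² f(C,s,x₀)²`
(noiseless coefficients; the read-out `x` only affects signs, `pathCoeff_zero_proj_sq`).
[cite: AharonovEtAl2023, Lemma 3 and §5 (display before Theorem 4; proof of Theorem 5)] -/
theorem sum_frame_sum_pathSum_mul_pathSum {d : ℕ} (a b : (Fin (d + 1) → ι → Pauli) → ℂ)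
    (U : Fin d → Matrix (ι → Bool) (ι → Bool) ℂ) (ρ : Matrix (ι → Bool) (ι → Bool) ℂ) (x₀ : ι → Bool) :
    (2 : ℂ) ^ Fintype.card ι * ∑ W : Fin (d + 1) → ι → Pauli, ∑ x : ι → Bool,
        (∑ s, a s * pathCoeff 0 (frameLayers U W) ρ (frameObs (proj x) W) s) *
          (∑ s, b s * pathCoeff 0 (frameLayers U W) ρ (frameObs (proj x) W) s) =
      ((4 : ℂ) ^ Fintype.card ι) ^ (d + 1) *
        ∑ s, a s * b s * (((2 : ℂ) ^ Fintype.card ι) ^ 2 * pathCoeff 0 U ρ (proj x₀) s ^ 2) := by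
  classical
  set c : ℂ := ((4 : ℂ) ^ Fintype.card ι) ^ (d + 1) with hc
  have hx : ∀ x : ι → Bool, ∑ W : Fin (d + 1) → ι → Pauli,
      (∑ s, a s * pathCoeff 0 (frameLayers U W) ρ (frameObs (proj x) W) s) *
        (∑ s, b s * pathCoeff 0 (frameLayers U W) ρ (frameObs (proj x) W) s) =
      c * ∑ s, a s * b s * pathCoeff 0 U ρ (proj x₀) s ^ 2 := by
    intro x
    rw [sum_frame_wsum_mul_wsum_pathCoeff 0 0 a b U ρ (proj x) (proj x)]
    congr 1
    refine Finset.sum_congr rfl fun s _ => ?_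
    rw [← sq, pathCoeff_zero_proj_sq U ρ x x₀ s]
  rw [Finset.sum_comm, Finset.sum_congr rfl fun x _ => hx x, Finset.sum_const, Finset.card_univ,
    nsmul_eq_mul, Fintype.card_fun, Fintype.card_bool, Finset.mul_sum, Finset.mul_sum, Finset.mul_sum,
    Finset.mul_sum]
  push_cast
  refine Finset.sum_congr rfl fun s _ => ?_
  ring

end PauliPath

end Literature.Computability.QuantumComplexity
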